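import Literature.MathematicalPhysics.QuantumFieldTheory.Balaban1983to89.B9Eq349ConjugatedQLetters
import Literature.MathematicalPhysics.QuantumFieldTheory.Balaban1983to89.B9Eq315QLipschitzL2TwoBackgrounds

/-!
# `Balaban1983to89.B9Eq349ConjugatedQLettersTwoBackgrounds` — T. Bałaban, *Propagators for lattice gauge theories in a background field*, Commun. Math.
# Phys. **99** (1985) 389–434 [Balaban1985BackgroundPropagators] (3.15)–(3.16) p. 393, (3.49) p. 399, (3.78)–(3.79) p. 406, (3.83) p. 407, (3.101) p. 414,
# with [Balaban1985Averaging] Proposition 7 p. 43, (124)–(126) p. 36: **THE CONJUGATED TWO-BACKGROUND LETTER OF THE ONE-STEP VECTOR AVERAGING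
# `Q(U) − Q(V)` IN `ℓ²`** — `Σ_c‖(Q(U)(w_c•A))(c) − (Q(V)(w_c•A))(c)‖² ≤ ((1 + 2‖κ‖ℓ′)·2d·75497472(d+1)N·δ)²·Σ_b‖A b‖²`, `w_c(b) = e^{κχ′(c₋)}e^{−κχ(b₋)}`,
# `N = (2d+2)L` — the brick the tower file `B9Eq349ConjugatedQTowerLettersTwoBackgrounds` telescopes over the levels

statement-level skeleton of published theorems with citation tags; proofs where landed; nothing here is a claim about the Yang–Mills mass gap

PDF held: `paper:balaban1985-cmp99-background-propagators` (journal page = PDF page + 388): p. 393 (3.15)–(3.16), p. 399 (3.49), p. 407 (3.83) («with the norm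
|A′| restricted to the blocks»), p. 414 (3.101) — re-read through the held text and the verbatim quotations of the two suppliers.

CITATION HEADER (lean-in-tree rule 2026-08-18).  Audit cell `pub-balaban`, sub-cell `t4`, NE9 crux team (2): LEAF PROVER 01
(`b2b-balaban-t4-ne9-formalise-leaf-01` gen 90), file 1 of the batch «the `δ_Q` ∕ `δ_Q′` conjuncts of the N52 road (α) END».  WHY: after this lineage's
I-13 `B9Eq326DeltaABlockDecayTowerTwoBackgroundsCurv` (gen 88) the big-block `L²` decay constant of `G₁,k(V) − G₁,k(U)` still DISPLAYS (its `hT2'`) the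
CONJUGATED two-background letters `δ_R` (non-local `R_k`) and `δ_Q` ∕ `δ_Q′` — `‖S_F((Q_k(V) − Q_k(U))(S⁻¹f))‖ ≤ δ_Q‖f‖` and the adjoint twin, with `δ_Q`
proportional to the closeness of the two backgrounds (the END is a Lipschitz reading; the cheap split `S_F(Q_V − Q_U)S⁻¹ = [S_FQ_VS⁻¹ − Q_V] − [S_FQ_US⁻¹ − Q_U]
+ [Q_V − Q_U]` is `O(‖κ‖ℓ′)`, not `O(δ)`, hence useless).  This file is the ONE-STEP brick on any torus `T_{LP} → T_P`; the tower telescoping, the reading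
on the chain's carriers and the companion shape are the siblings.  TEMPLATES CREDITED: the NE9 OWNER lineage `b2b-balaban-t4-ne9-p1` gen 93
(`B9Eq349ConjugatedQLetters.sum_norm_sq_QtorusLin_conj_le`: the one-family brick by the flat count + the local Lipschitz letter; `norm_ratio_sub_one_le`) and
ne9-leaf-04 (`B9Eq315QLipschitzL2TwoBackgrounds.sum_norm_sq_QtorusLin_sub_QtorusLin_le`: the one-step two-background Hilbert letter, volume-free;
`B9Eq383QSemiLocal`: semi-locality `QtorusLin_congr_local`, the multiplicity count `sum_sum_near_le`).  Print never conjugates `Q(U)`; the device is the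
ROUTE's and every constant below is the cell's.

WHAT IS PROVED (sorry-free; proof lane — no `def`; [folklore] finite sums; nothing of [B9]∕[B7] asserted).  Data: the one-step torus `T_{LP} → T_P`, two
backgrounds `U`, `V` with the (3.35)-type letters of `B9Eq315QTorus` (`hα1 hU1 hreg`, `hα1′ hV1 hregV`, `α′ ≤ 1∕128`), multiplicative closeness
`‖U(b)V(b)⁻¹ − 1‖ ≤ δ ≤ 1∕(12288N)`; cut-offs `χ` (fine sites), `χ′` (coarse sites) with the TWO-BLOCK reading `|χ′(c₋) − χ(b₋)| ≤ ℓ′` whenever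
`b₋ ∈ B(c₋) ∪ B(c₊)`, window `‖κ‖ℓ′ ≤ 1`.
* `smul_QtorusLin_smul_apply` (linearity: `a•(Q(σ•A))(c) = (Q((aσ)•A))(c)`), `norm_ratio_le` (`‖e^{κχ′(c₋)}e^{−κχ(b₋)}‖ ≤ 1 + 2‖κ‖ℓ′` near `c`),
  **`sum_norm_sq_QtorusLin_sub_QtorusLin_conj_le`** — THE BRICK displayed in the title: per coarse bond TRUNCATE `w_c•A` to the fine bonds based in
  `B(c₋) ∪ B(c₊)` (both `Q`'s are semi-local), bound the `c`-term by the WHOLE `ℓ²` sum of the one-step two-background letter at the truncated input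
  (`≤ 2d(Kδ)²·(1 + 2‖κ‖ℓ′)²·Σ_{b near c}‖A b‖²`), then `sum_sum_near_le` (multiplicity `2d`) — no new geometry.
MODEL ∕ DECLARED READINGS.  Those of the two suppliers (`𝔸` a complete normed `ℂ`-algebra with `‖1‖ = 1`; the regularity, smallness and closeness letters
DISPLAYED — [B7] Prop. 2 and the Lipschitz continuity of `U ↦ Ū` NOT proved here).
HONEST SCOPE.  [folklore]; crude constant (`(1 + 2‖κ‖ℓ′)·2d` where `√(2d)` enters twice); one step only; nothing of [B9] Thm 3.1∕3.3∕3.11 or [B7] Prop. 2∕7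
asserted, valued or discharged; «NE9 ⇐ the named binders»; NE9 NOT PRINTED ∕ NOT PROVED; NOT summit progress (cell pub-balaban: row NE9 WALLED ON A MODEL
(O-NE9-1; #5 UNRULED); spine PROVED 0∕9; rung (B)+1 on a finite T⁴ — NOT infinite volume, NOT mass gap, NOT BetaPertH, NOT Clay; HONEST DEPENDENCY: continuum YM
on T⁴ ⇐ BetaPertH ∧ nine spine estimates (0/9 proved); BetaPertH ⇐ (D1) ∧ (D4) ∧ CAP+tail; G-an2-4 gates asym, D1 and NE2/3/4).  NEW file; nothing modified.
Net new unproved facts: 0.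
-/

noncomputable section

open scoped BigOperators

namespace Literature.MathematicalPhysics.QuantumFieldTheory.Balaban1983to89.B9Eq349ConjugatedQLettersTwoBackgrounds

open B4Sect5Torus (TSite)
open B9SectCLatticeCarrier (Bond shift)
open B7Prop1Explicit (U1 Wcx boxVec)
open B9Eq319QprimeTorus (fineP blockCoord)
open B9Eq315QTorus (perCfg cornerSite QtorusLin)
open B9Eq315QLipschitzL2TwoBackgrounds (sum_norm_sq_QtorusLin_sub_QtorusLin_le)
open B9Eq383QSemiLocal (QtorusLin_congr_local sum_sum_near_le)
open B9Eq349ConjugatedQLetters (norm_ratio_sub_one_le)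

variable {d : ℕ} (L : ℕ) [NeZero L]

/-! ## §1 Linearity, the ratio weights, the brick -/

section Brick

variable {𝔸 : Type*} [NormedRing 𝔸] [NormOneClass 𝔸] [NormedAlgebra ℂ 𝔸] [CompleteSpace 𝔸]
  (P : Fin d → ℕ) [∀ i, NeZero (fineP L P i)] (hL : 1 ≤ L)
  (U : Bond d (fineP L P) → 𝔸ˣ) {α : ℝ} (hα1 : α ≤ 1 / 64)
  (hU1 : ∀ (x : B7Prop1Explicit.Site d) (κ : Fin d), perCfg (fineP L P) U x κ ∈ U1 𝔸)
  (hreg : ∀ (y : TSite d P) (κ : Fin d) (r : Fin d → Fin L),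
    ‖((Wcx L (perCfg (fineP L P) U) (cornerSite L y) κ (boxVec L r) : 𝔸ˣ) : 𝔸) - 1‖ ≤ α)
  (V : Bond d (fineP L P) → 𝔸ˣ) {α' : ℝ} (hα1' : α' ≤ 1 / 64)
  (hV1 : ∀ (x : B7Prop1Explicit.Site d) (κ : Fin d), perCfg (fineP L P) V x κ ∈ U1 𝔸)
  (hregV : ∀ (y : TSite d P) (κ : Fin d) (r : Fin d → Fin L),
    ‖((Wcx L (perCfg (fineP L P) V) (cornerSite L y) κ (boxVec L r) : 𝔸ˣ) : 𝔸) - 1‖ ≤ α')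
  (hα' : α' ≤ 1 / 128)
  {δ : ℝ} (hδ : 0 ≤ δ) (hδmax : δ ≤ 1 / (12288 * ((2 * (d * L) + L + L : ℕ) : ℝ)))
  (hUVδ : ∀ b : Bond d (fineP L P), ‖((U b : 𝔸ˣ) : 𝔸) * (((V b)⁻¹ : 𝔸ˣ) : 𝔸) - 1‖ ≤ δ)
  {κ : ℂ} {χ : TSite d (fineP L P) → ℝ} {χ' : TSite d P → ℝ} {ℓ' : ℝ} (hℓ' : 0 ≤ ℓ')
  (hχ' : ∀ (c : Bond d P) (b : Bond d (fineP L P)), (blockCoord L P b.1 = c.1 ∨ blockCoord L P b.1 = shift c.2 c.1) → |χ' c.1 - χ b.1| ≤ ℓ')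
  (hwin : ‖κ‖ * ℓ' ≤ 1)

omit [NeZero L] in
/-- **LINEARITY**: `a•(Q(U)(σ•A))(c) = (Q(U)((a·σ)•A))(c)` — the outer weight at the coarse bond moves inside. [folklore]
[cite: Balaban1985BackgroundPropagators, (3.15) p.393, (3.101) p.414] -/
theorem smul_QtorusLin_smul_apply (a : ℂ) (σ : Bond d (fineP L P) → ℂ) (A : Bond d (fineP L P) → 𝔸) (c : Bond d P) :
    a • QtorusLin L P hL U hα1 hU1 hreg (fun b => σ b • A b) c = QtorusLin L P hL U hα1 hU1 hreg (fun b => (a * σ b) • A b) c := by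
  have hfun : (a • fun b => σ b • A b) = fun b => (a * σ b) • A b := by
    funext b; simp only [Pi.smul_apply, smul_smul]
  rw [← Pi.smul_apply a, ← LinearMap.map_smul, hfun]

omit [NeZero L] in
/-- **`‖e^{κa}·e^{−κb}‖ ≤ 1 + 2‖κ‖ℓ′`** for `|a − b| ≤ ℓ′` in the window `‖κ‖ℓ′ ≤ 1` (gen 93's `norm_ratio_sub_one_le` plus the triangle inequality).
[folklore] [cite: Balaban1985BackgroundPropagators, (3.49) p.399] -/
theorem norm_ratio_le {a b : ℝ} (hab : |a - b| ≤ ℓ') (hwin : ‖κ‖ * ℓ' ≤ 1) :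
    ‖Complex.exp (κ * (a : ℂ)) * Complex.exp (-(κ * (b : ℂ)))‖ ≤ 1 + 2 * (‖κ‖ * ℓ') := by
  have h := norm_ratio_sub_one_le hab hwin
  have h1 := norm_le_norm_add_norm_sub' (Complex.exp (κ * (a : ℂ)) * Complex.exp (-(κ * (b : ℂ)))) 1
  rw [norm_one] at h1
  linarith

include hα' hδ hδmax hUVδ hℓ' hχ' hwin in
/-- **THE BRICK — the conjugated two-background one-step letter in `ℓ²`**: `Σ_c ‖(Q(U)(w_c•A))(c) − (Q(V)(w_c•A))(c)‖² ≤
((1 + 2‖κ‖ℓ′)·2d·75497472(d+1)N·δ)²·Σ_b ‖A b‖²`, `w_c(b) = e^{κχ′(c₋)}e^{−κχ(b₋)}`.  Per coarse bond: truncate `w_c•A` to the fine bonds based in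
`B(c₋) ∪ B(c₊)` (`QtorusLin_congr_local` for both backgrounds), bound the single `c`-term by the whole `ℓ²` sum of `sum_norm_sq_QtorusLin_sub_QtorusLin_le`
at the truncated input, `‖w_c‖ ≤ 1 + 2‖κ‖ℓ′` there (`norm_ratio_le`); then `sum_sum_near_le`.
[cite: Balaban1985BackgroundPropagators, (3.15)–(3.16) p.393, (3.49) p.399, (3.78)–(3.79) p.406, (3.83) p.407, (3.101) p.414; Balaban1985Averaging, Proposition 7 p.43, (124)–(126) p.36] -/
theorem sum_norm_sq_QtorusLin_sub_QtorusLin_conj_le (A : Bond d (fineP L P) → 𝔸) :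
    ∑ c : Bond d P, ‖QtorusLin L P hL U hα1 hU1 hreg
          (fun b => (Complex.exp (κ * (χ' c.1 : ℂ)) * Complex.exp (-(κ * (χ b.1 : ℂ)))) • A b) c -
        QtorusLin L P hL V hα1' hV1 hregV
          (fun b => (Complex.exp (κ * (χ' c.1 : ℂ)) * Complex.exp (-(κ * (χ b.1 : ℂ)))) • A b) c‖ ^ 2 ≤
      ((1 + 2 * (‖κ‖ * ℓ')) * (2 * d) * (75497472 * ((d : ℝ) + 1) * ((2 * (d * L) + L + L : ℕ) : ℝ) * δ)) ^ 2 *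
        ∑ b : Bond d (fineP L P), ‖A b‖ ^ 2 := by
  classical
  set K : ℝ := 75497472 * ((d : ℝ) + 1) * ((2 * (d * L) + L + L : ℕ) : ℝ) * δ with hK
  have hK0 : 0 ≤ K := by rw [hK]; positivity
  set ω : ℝ := 1 + 2 * (‖κ‖ * ℓ') with hω
  have hω0 : 0 ≤ ω := by rw [hω]; positivity
  -- the ratio weights and their size near `c`
  set r : Bond d P → Bond d (fineP L P) → ℂ := fun c b => Complex.exp (κ * (χ' c.1 : ℂ)) * Complex.exp (-(κ * (χ b.1 : ℂ))) with hr
  have hrω : ∀ (c : Bond d P) (b : Bond d (fineP L P)), (blockCoord L P b.1 = c.1 ∨ blockCoord L P b.1 = shift c.2 c.1) → ‖r c b‖ ≤ ω :=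
    fun c b hb => norm_ratio_le (κ := κ) (hχ' c b hb) hwin
  -- the local sizes of `A`
  set s : Bond d P → ℝ := fun c => Real.sqrt (∑ b ∈ Finset.univ.filter
    (fun b : Bond d (fineP L P) => blockCoord L P b.1 = c.1 ∨ blockCoord L P b.1 = shift c.2 c.1), ‖A b‖ ^ 2) with hs
  have hsc : ∀ c : Bond d P, s c ^ 2 = ∑ b ∈ Finset.univ.filter
      (fun b : Bond d (fineP L P) => blockCoord L P b.1 = c.1 ∨ blockCoord L P b.1 = shift c.2 c.1), ‖A b‖ ^ 2 := fun c =>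
    Real.sq_sqrt (Finset.sum_nonneg fun _ _ => sq_nonneg _)
  -- (i) pointwise on the coarse bonds: truncation + the whole `ℓ²` letter
  have hpt : ∀ c : Bond d P, ‖QtorusLin L P hL U hα1 hU1 hreg (fun b => r c b • A b) c - QtorusLin L P hL V hα1' hV1 hregV (fun b => r c b • A b) c‖ ^ 2 ≤
      2 * d * K ^ 2 * (ω ^ 2 * s c ^ 2) := by
    intro c
    set A' : Bond d (fineP L P) → 𝔸 := fun b =>
      if blockCoord L P b.1 = c.1 ∨ blockCoord L P b.1 = shift c.2 c.1 then r c b • A b else 0 with hA'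
    have hAA' : ∀ b : Bond d (fineP L P), (blockCoord L P b.1 = c.1 ∨ blockCoord L P b.1 = shift c.2 c.1) → r c b • A b = A' b :=
      fun b hb => by rw [hA']; dsimp only; rw [if_pos hb]
    have hA'g : ∀ b, ‖A' b‖ ^ 2 ≤ ω ^ 2 * (if blockCoord L P b.1 = c.1 ∨ blockCoord L P b.1 = shift c.2 c.1 then ‖A b‖ ^ 2 else 0) := fun b => by
      rw [hA']; dsimp only
      split_ifs with hb
      · rw [← mul_pow]
        exact pow_le_pow_left₀ (norm_nonneg _) ((norm_smul_le _ _).trans (mul_le_mul_of_nonneg_right (hrω c b hb) (norm_nonneg _))) 2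
      · rw [norm_zero, zero_pow two_ne_zero, mul_zero]
    have hA's : ∑ b, ‖A' b‖ ^ 2 ≤ ω ^ 2 * s c ^ 2 := by
      calc ∑ b, ‖A' b‖ ^ 2 ≤ ∑ b, ω ^ 2 * (if blockCoord L P b.1 = c.1 ∨ blockCoord L P b.1 = shift c.2 c.1 then ‖A b‖ ^ 2 else 0) :=
            Finset.sum_le_sum fun b _ => hA'g b
        _ = ω ^ 2 * s c ^ 2 := by rw [← Finset.mul_sum, ← Finset.sum_filter, hsc c]
    rw [QtorusLin_congr_local L P hL U hα1 hU1 hreg c hAA', QtorusLin_congr_local L P hL V hα1' hV1 hregV c hAA']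
    have hglob := sum_norm_sq_QtorusLin_sub_QtorusLin_le L P hL U hα1 hU1 hreg V hα1' hV1 hregV hα' hδ hδmax hUVδ A'
    rw [← hK] at hglob
    calc ‖QtorusLin L P hL U hα1 hU1 hreg A' c - QtorusLin L P hL V hα1' hV1 hregV A' c‖ ^ 2
        ≤ ∑ c' : Bond d P, ‖QtorusLin L P hL U hα1 hU1 hreg A' c' - QtorusLin L P hL V hα1' hV1 hregV A' c'‖ ^ 2 :=
          Finset.single_le_sum (f := fun c' => ‖QtorusLin L P hL U hα1 hU1 hreg A' c' - QtorusLin L P hL V hα1' hV1 hregV A' c'‖ ^ 2)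
            (fun _ _ => sq_nonneg _) (Finset.mem_univ c)
      _ ≤ 2 * d * K ^ 2 * ∑ b, ‖A' b‖ ^ 2 := hglob
      _ ≤ 2 * d * K ^ 2 * (ω ^ 2 * s c ^ 2) := mul_le_mul_of_nonneg_left hA's (by positivity)
  -- (ii) the global count
  have hS1 : ∑ c : Bond d P, s c ^ 2 ≤ 2 * d * ∑ b : Bond d (fineP L P), ‖A b‖ ^ 2 := by
    rw [Finset.sum_congr rfl fun c _ => hsc c]
    exact sum_sum_near_le L P (fun b => ‖A b‖ ^ 2) fun _ => sq_nonneg _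
  -- (iii) assemble
  calc ∑ c : Bond d P, ‖QtorusLin L P hL U hα1 hU1 hreg (fun b => r c b • A b) c - QtorusLin L P hL V hα1' hV1 hregV (fun b => r c b • A b) c‖ ^ 2
      ≤ ∑ c : Bond d P, 2 * d * K ^ 2 * (ω ^ 2 * s c ^ 2) := Finset.sum_le_sum fun c _ => hpt c
    _ = 2 * d * K ^ 2 * ω ^ 2 * ∑ c : Bond d P, s c ^ 2 := by rw [Finset.mul_sum]; exact Finset.sum_congr rfl fun c _ => by ring
    _ ≤ 2 * d * K ^ 2 * ω ^ 2 * (2 * d * ∑ b : Bond d (fineP L P), ‖A b‖ ^ 2) := mul_le_mul_of_nonneg_left hS1 (by positivity)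
    _ = (ω * (2 * d) * K) ^ 2 * ∑ b : Bond d (fineP L P), ‖A b‖ ^ 2 := by ring

end Brick

end Literature.MathematicalPhysics.QuantumFieldTheory.Balaban1983to89.B9Eq349ConjugatedQLettersTwoBackgrounds

end
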